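import Mathlib
import Literature.NumberTheory.Irrationality.DirichletLValues.ChowlaMilnor
import Literature.NumberTheory.Irrationality.DirichletLValues.ChowlaMilnorConjugatesProofs
import HarnessLib

/-!
# The odd/even decomposition `V_k(q) = V_k^+(q) + V_k^−(q)` and Lai–Li's equivalent form of the
# Chowla–Milnor conjecture (Gun–Murty–Rath 2011, p. 1332 / p. 1334; Lai–Li 2025, (1.1) and Conj. 1.4)

Topic `Literature/NumberTheory/Irrationality/DirichletLValues`. Proofs-only leaf (theorems only, no definition, no
named fact, no `sorry`; cell pub-zeta5, P1 g54) beside `ChowlaMilnor.lean` (the TYPED odd space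
`oddChowlaMilnorSpace k q = V_k^−(q)`, Lai–Li), `ChowlaMilnorEvenProofs.lean` (`dim_ℚ V_k^+(q) = φ(q)/2`, Okada) and
`ChowlaMilnorSpaceProofs.lean` (`V_k(q)`, the coprime sum).

## Sources (read on the page)

* S. Gun, M. R. Murty, P. Rath, *On a conjecture of Chowla and Milnor*, Canad. J. Math. **63** (2011) 1328–1344
  [GunRammurtyRath2011]: Definition 1 (p. 1329) `V_k(q) = ℚ-Span of {ζ(k, a/q) : 1 ≤ a < q, (a, q) = 1}`; p. 1330
  «The Chowla–Milnor conjecture asserts that the dimension of `V_k(q)` for `k > 1` is `φ(q)`»; Theorem 1 (p. 1330)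
  «Let `k > 1` and `q > 2`, then `dim_ℚ V_k(q) ≥ φ(q)/2`»; proof of Theorem 1 (p. 1332) «the space `V_k(q)` is also
  spanned by the following sets of real numbers: `{ζ(k, a/q) + ζ(k, 1 − a/q) | (a, q) = 1, 1 ≤ a < q/2}`,
  `{ζ(k, a/q) − ζ(k, 1 − a/q) | (a, q) = 1, 1 ≤ a < q/2}`. We define the following `ℚ`-linear subspaces of `V_k(q)`:
  `V_k(q)^+ = …`, `V_k(q)^− = …`»; p. 1334 «Thus, we have the following bound `φ(q)/2 ≤ dim_ℚ V_k(q) ≤ φ(q)`».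
* L. Lai, J. Li, *A partial result towards the Chowla–Milnor conjecture*, arXiv:2505.12687 [LaiLi2025]: Definition 1.3
  (p. 2) `ζ^±(k,a/q) := ζ(k,a/q) ± (−1)^k ζ(k,1−a/q)`, `V_k^±(q) := Span_ℚ {ζ^±(k,a/q) | 1 ≤ a < q/2, gcd(a,q) = 1}`;
  (1.1) `dim_ℚ V_k^+(q) = φ(q)/2`; «**Conjecture 1.4** (equivalent form of the Chowla–Milnor conjecture): for all
  `k ≥ 2`, `q ≥ 3`: (1) `dim_ℚ V_k^−(q) = φ(q)/2`; (2) `V_k^+(q) ∩ V_k^−(q) = {0}`».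

## What is proved (theorems only; `V_k(q)` and `V_k^+(q)` WRITTEN OUT as in the companion files, `V_k^−(q)` = the
typed `oddChowlaMilnorSpace k q`)

* `oddChowlaMilnorSpace_le_span`, `span_le_even_sup_odd`, **`even_sup_odd_eq_span`** — `V_k(q) = V_k^+(q) + V_k^−(q)`
  («also spanned by», p. 1332);
* `finrank_oddChowlaMilnorSpace_le` (`dim V_k^−(q) ≤ φ(q)/2`), **`totient_div_two_le_finrank_span`** (THEOREM 1,
  literally) and **`finrank_span_le_totient`** (the p. 1334 display `φ(q)/2 ≤ dim_ℚ V_k(q) ≤ φ(q)`);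
* `finrank_span_add_finrank_inf` — `dim V_k(q) + dim (V_k^+ ∩ V_k^−) = φ(q)/2 + dim V_k^−(q)`;
* **`finrank_span_eq_totient_iff`** — LAI–LI'S EQUIVALENT FORM AS A THEOREM: `dim_ℚ V_k(q) = φ(q)` iff
  `dim_ℚ V_k^−(q) = φ(q)/2` and `V_k^+(q) ∩ V_k^−(q) = {0}` (`k ≥ 2`, `q ≥ 3`); `finrank_span_lt_totient_of_mem_inf` —
  a non-zero element of `V_k^+ ∩ V_k^−` refutes the Chowla–Milnor conjecture at `(k, q)`;
* `sum_coprime_hurwitzValue_mem_oddChowlaMilnorSpace` — for ODD `k` the coprime sum `Σ_{(a,q)=1} ζ(k, a/q)`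
  (`= J_k(q)·ζ(k)`, `ChowlaMilnorSpaceProofs`) lies in `V_k^−(q)` (p. 1338: «`ζ(k)/(2πi)^k` lies in the subspace
  generated by the `(ζ(k, a/q) + ζ(k, 1 − a/q))/(2πi)^k`»).

HONEST FRAMING (cells pub-zeta5 / zeta5-irr): kernel theorems of PRINTED statements and of Lai–Li's remark that
Conjecture 1.4 is an equivalent form of the Chowla–Milnor conjecture; both conjectures stay OPEN and appear only as
the two sides of an iff; net named-fact debt 0; nothing here concerns `ζ(5)`.
-/

noncomputable section

open Finset Complex

open scoped Nat

namespace Literature.NumberTheory.Irrationality.DirichletLValues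

open Literature.NumberTheory.Transcendental

/-! ### `V_k^−(q) ≤ V_k(q)` and `V_k(q) = V_k^+(q) + V_k^−(q)` -/

/-- **`V_k^−(q) ≤ V_k(q)`**: each `ζ(k, a/q) − (−1)^k ζ(k, 1 − a/q)` is `ζ(k, a/q) − (−1)^k ζ(k, (q−a)/q)` with
`(q − a, q) = 1` («`ℚ`-linear subspaces of `V_k(q)`», p. 1332). [cite: GunRammurtyRath2011, proof of Theorem 1 (p. 1332)]
[cite: LaiLi2025, Definition 1.3 (p. 2)] -/
theorem oddChowlaMilnorSpace_le_span {k q : ℕ} (hq : 2 ≤ q) :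
    oddChowlaMilnorSpace k q ≤
      Submodule.span ℚ {y : ℝ | ∃ a : ℕ, 1 ≤ a ∧ a < q ∧ Nat.Coprime a q ∧ y = hurwitzValue k ((a : ℝ) / q)} := by
  refine Submodule.span_le.2 ?_
  rintro y ⟨a, ha1, h2a, hcop, rfl⟩
  have haq : a < q := by omega
  have hq0 : (q : ℝ) ≠ 0 := by exact_mod_cast (show q ≠ 0 by omega)
  have hcop' : Nat.Coprime (q - a) q := (Nat.coprime_self_sub_left haq.le).2 hcop
  have e : (1 : ℝ) - (a : ℝ) / q = ((q - a : ℕ) : ℝ) / q := by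
    rw [Nat.cast_sub haq.le]
    field_simp
  unfold hurwitzOdd
  rw [e]
  refine Submodule.sub_mem _ (hurwitzValue_mem_span ha1 haq hcop) ?_
  rw [show (-1 : ℝ) ^ k * hurwitzValue k (((q - a : ℕ) : ℝ) / q) =
      ((-1 : ℚ) ^ k) • hurwitzValue k (((q - a : ℕ) : ℝ) / q) by rw [Rat.smul_def]; push_cast; rfl]
  exact Submodule.smul_mem _ _ (hurwitzValue_mem_span (by omega) (by omega) hcop')

/-- For `q ≥ 3` a residue coprime to `q` is not `q/2`. [folklore] -/
private theorem two_mul_ne_of_coprime' {q a : ℕ} (hq : 3 ≤ q) (h : Nat.Coprime a q) : 2 * a ≠ q := by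
  intro h2
  have ha : a ∣ q := ⟨2, by omega⟩
  have : a = 1 := Nat.Coprime.eq_one_of_dvd h ha
  omega

/-- **`V_k(q) ≤ V_k^+(q) + V_k^−(q)`** (`q ≥ 3`): `2ζ(k, a/q) = ζ^+(k,a/q) + ζ^−(k,a/q)` for `a < q/2`, and for `a > q/2`,
`b = q − a`, `2(−1)^k ζ(k, a/q) = ζ^+(k,b/q) − ζ^−(k,b/q)` («the space `V_k(q)` is also spanned by the following sets»,
p. 1332). [cite: GunRammurtyRath2011, proof of Theorem 1 (p. 1332)] [cite: LaiLi2025, Definition 1.3 (p. 2)] -/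
theorem span_le_even_sup_odd {k q : ℕ} (hq : 3 ≤ q) :
    Submodule.span ℚ {y : ℝ | ∃ a : ℕ, 1 ≤ a ∧ a < q ∧ Nat.Coprime a q ∧ y = hurwitzValue k ((a : ℝ) / q)} ≤
      Submodule.span ℚ {y : ℝ | ∃ a : ℕ, 1 ≤ a ∧ 2 * a < q ∧ Nat.Coprime a q ∧
          y = hurwitzValue k ((a : ℝ) / q) + (-1 : ℝ) ^ k * hurwitzValue k (1 - (a : ℝ) / q)} ⊔
        oddChowlaMilnorSpace k q := by
  refine Submodule.span_le.2 ?_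
  rintro y ⟨a, ha1, haq, hcop, rfl⟩
  have hq0 : (q : ℝ) ≠ 0 := by exact_mod_cast (show q ≠ 0 by omega)
  rcases lt_or_gt_of_ne (two_mul_ne_of_coprime' hq hcop) with h2a | h2a
  · -- `a < q/2`
    have hp : hurwitzValue k ((a : ℝ) / q) + (-1 : ℝ) ^ k * hurwitzValue k (1 - (a : ℝ) / q) ∈
        Submodule.span ℚ {y : ℝ | ∃ a : ℕ, 1 ≤ a ∧ 2 * a < q ∧ Nat.Coprime a q ∧
          y = hurwitzValue k ((a : ℝ) / q) + (-1 : ℝ) ^ k * hurwitzValue k (1 - (a : ℝ) / q)} :=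
      Submodule.subset_span ⟨a, ha1, h2a, hcop, rfl⟩
    have hm : hurwitzOdd k ((a : ℝ) / q) ∈ oddChowlaMilnorSpace k q :=
      Submodule.subset_span ⟨a, ha1, h2a, hcop, rfl⟩
    have e : hurwitzValue k ((a : ℝ) / q) = (1 / 2 : ℚ) •
        ((hurwitzValue k ((a : ℝ) / q) + (-1 : ℝ) ^ k * hurwitzValue k (1 - (a : ℝ) / q)) +
          hurwitzOdd k ((a : ℝ) / q)) := by
      rw [Rat.smul_def, hurwitzOdd]
      push_cast
      ring
    rw [e]
    exact Submodule.smul_mem _ _ (Submodule.add_mem_sup hp hm)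
  · -- `a > q/2`: use `b = q − a`
    set b : ℕ := q - a with hb
    have hb1 : 1 ≤ b := by omega
    have h2b : 2 * b < q := by omega
    have hcopb : Nat.Coprime b q := (Nat.coprime_self_sub_left haq.le).2 hcop
    have eb : (b : ℝ) / q = 1 - (a : ℝ) / q := by
      rw [hb, Nat.cast_sub haq.le]
      field_simp
    have eb' : (1 : ℝ) - (b : ℝ) / q = (a : ℝ) / q := by rw [eb]; ring
    have hp : hurwitzValue k ((b : ℝ) / q) + (-1 : ℝ) ^ k * hurwitzValue k (1 - (b : ℝ) / q) ∈
        Submodule.span ℚ {y : ℝ | ∃ a : ℕ, 1 ≤ a ∧ 2 * a < q ∧ Nat.Coprime a q ∧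
          y = hurwitzValue k ((a : ℝ) / q) + (-1 : ℝ) ^ k * hurwitzValue k (1 - (a : ℝ) / q)} :=
      Submodule.subset_span ⟨b, hb1, h2b, hcopb, rfl⟩
    have hm : hurwitzOdd k ((b : ℝ) / q) ∈ oddChowlaMilnorSpace k q :=
      Submodule.subset_span ⟨b, hb1, h2b, hcopb, rfl⟩
    have hsq : ((-1 : ℝ) ^ k) * (-1 : ℝ) ^ k = 1 := by
      rw [← mul_pow]; norm_num
    have e : hurwitzValue k ((a : ℝ) / q) = ((-1 : ℚ) ^ k / 2) •
        ((hurwitzValue k ((b : ℝ) / q) + (-1 : ℝ) ^ k * hurwitzValue k (1 - (b : ℝ) / q)) -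
          hurwitzOdd k ((b : ℝ) / q)) := by
      rw [Rat.smul_def, hurwitzOdd, eb']
      push_cast
      linear_combination (-(hurwitzValue k ((a : ℝ) / q))) * hsq
    rw [e]
    exact Submodule.smul_mem _ _ (Submodule.sub_mem_sup hp hm)

/-- **`V_k(q) = V_k^+(q) + V_k^−(q)`** (`q ≥ 3`). [cite: GunRammurtyRath2011, proof of Theorem 1 (p. 1332)]
[cite: LaiLi2025, Definition 1.3 and (1.1) (p. 2)] -/
theorem even_sup_odd_eq_span {k q : ℕ} (hq : 3 ≤ q) :
    Submodule.span ℚ {y : ℝ | ∃ a : ℕ, 1 ≤ a ∧ 2 * a < q ∧ Nat.Coprime a q ∧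
          y = hurwitzValue k ((a : ℝ) / q) + (-1 : ℝ) ^ k * hurwitzValue k (1 - (a : ℝ) / q)} ⊔
        oddChowlaMilnorSpace k q =
      Submodule.span ℚ {y : ℝ | ∃ a : ℕ, 1 ≤ a ∧ a < q ∧ Nat.Coprime a q ∧ y = hurwitzValue k ((a : ℝ) / q)} :=
  le_antisymm (sup_le (span_hurwitzEven_le_span (by omega)) (oddChowlaMilnorSpace_le_span (by omega)))
    (span_le_even_sup_odd hq)

/-! ### Dimension counts: `dim V_k^−(q) ≤ φ(q)/2`, `φ(q)/2 ≤ dim V_k(q) ≤ φ(q)` -/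

/-- The generating set of `V_k^−(q)` is the image of the half-system `{a < q : (a,q) = 1, 2a < q}`. [folklore] -/
private theorem oddGenerators_eq_image (k q : ℕ) (hq : 2 ≤ q) :
    {y : ℝ | ∃ a : ℕ, 1 ≤ a ∧ 2 * a < q ∧ Nat.Coprime a q ∧ y = hurwitzOdd k ((a : ℝ) / q)} =
      ((((range q).filter q.Coprime).filter fun a => 2 * a < q).image
        fun a : ℕ => hurwitzOdd k ((a : ℝ) / q) : Finset ℝ) := by
  ext y
  simp only [Set.mem_setOf_eq, Finset.coe_image, Set.mem_image, Finset.mem_coe, Finset.mem_filter,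
    Finset.mem_range]
  constructor
  · rintro ⟨a, ha1, h2a, hcop, rfl⟩
    exact ⟨a, ⟨⟨by omega, hcop.symm⟩, h2a⟩, rfl⟩
  · rintro ⟨a, ⟨⟨haq, hcop⟩, h2a⟩, rfl⟩
    refine ⟨a, ?_, h2a, hcop.symm, rfl⟩
    rcases Nat.eq_zero_or_pos a with rfl | hpos
    · rw [Nat.coprime_zero_right] at hcop
      omega
    · exact hpos

/-- The generating set of `V_k(q)` is the image of the coprime residues `{a < q : (a,q) = 1}`. [folklore] -/
private theorem generators_eq_image (k q : ℕ) (hq : 2 ≤ q) :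
    {y : ℝ | ∃ a : ℕ, 1 ≤ a ∧ a < q ∧ Nat.Coprime a q ∧ y = hurwitzValue k ((a : ℝ) / q)} =
      (((range q).filter q.Coprime).image fun a : ℕ => hurwitzValue k ((a : ℝ) / q) : Finset ℝ) := by
  ext y
  simp only [Set.mem_setOf_eq, Finset.coe_image, Set.mem_image, Finset.mem_coe, Finset.mem_filter,
    Finset.mem_range]
  constructor
  · rintro ⟨a, ha1, haq, hcop, rfl⟩
    exact ⟨a, ⟨haq, hcop.symm⟩, rfl⟩
  · rintro ⟨a, ⟨haq, hcop⟩, rfl⟩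
    refine ⟨a, ?_, haq, hcop.symm, rfl⟩
    rcases Nat.eq_zero_or_pos a with rfl | hpos
    · rw [Nat.coprime_zero_right] at hcop
      omega
    · exact hpos

/-- `V_k^−(q)` is finite-dimensional (finitely many generators). [folklore] -/
private theorem finiteDimensional_odd (k q : ℕ) (hq : 2 ≤ q) : FiniteDimensional ℚ ↥(oddChowlaMilnorSpace k q) := by
  unfold oddChowlaMilnorSpace
  rw [oddGenerators_eq_image k q hq]
  exact FiniteDimensional.span_finset ℚ _

/-- `V_k^+(q)` is finite-dimensional. [folklore] -/
private theorem finiteDimensional_even (k q : ℕ) :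
    FiniteDimensional ℚ ↥(Submodule.span ℚ {y : ℝ | ∃ a : ℕ, 1 ≤ a ∧ 2 * a < q ∧ Nat.Coprime a q ∧
      y = hurwitzValue k ((a : ℝ) / q) + (-1 : ℝ) ^ k * hurwitzValue k (1 - (a : ℝ) / q)}) := by
  refine FiniteDimensional.span_of_finite ℚ ?_
  refine ((Set.finite_Iio q).image (fun a : ℕ =>
    hurwitzValue k ((a : ℝ) / q) + (-1 : ℝ) ^ k * hurwitzValue k (1 - (a : ℝ) / q))).subset ?_
  rintro y ⟨a, -, h2a, -, rfl⟩
  exact ⟨a, (show a < q by simpa using (by omega : a < q)), rfl⟩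

/-- `V_k(q)` is finite-dimensional. [folklore] -/
private theorem finiteDimensional_span (k q : ℕ) (hq : 2 ≤ q) :
    FiniteDimensional ℚ ↥(Submodule.span ℚ {y : ℝ | ∃ a : ℕ, 1 ≤ a ∧ a < q ∧ Nat.Coprime a q ∧
      y = hurwitzValue k ((a : ℝ) / q)}) := by
  rw [generators_eq_image k q hq]
  exact FiniteDimensional.span_finset ℚ _

/-- **`dim_ℚ V_k^−(q) ≤ φ(q)/2`** (`q ≥ 3`): `V_k^−(q)` is spanned by `φ(q)/2` elements.
[cite: LaiLi2025, Definition 1.3 and Conjecture 1.4 (p. 2)] -/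
theorem finrank_oddChowlaMilnorSpace_le {k q : ℕ} (hq : 3 ≤ q) :
    Module.finrank ℚ ↥(oddChowlaMilnorSpace k q) ≤ Nat.totient q / 2 := by
  unfold oddChowlaMilnorSpace
  rw [oddGenerators_eq_image k q (by omega), ← card_halfSystem_eq hq]
  exact (finrank_span_finset_le_card _).trans Finset.card_image_le

/-- **`dim_ℚ V_k(q) ≤ φ(q)`** (`q ≥ 2`): `V_k(q)` is spanned by `φ(q)` elements (the upper half of the display
«`φ(q)/2 ≤ dim_ℚ V_k(q) ≤ φ(q)`», p. 1334). [cite: GunRammurtyRath2011, p. 1334 (display after (3))] -/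
theorem finrank_span_le_totient {k q : ℕ} (hq : 2 ≤ q) :
    Module.finrank ℚ ↥(Submodule.span ℚ {y : ℝ | ∃ a : ℕ, 1 ≤ a ∧ a < q ∧ Nat.Coprime a q ∧
        y = hurwitzValue k ((a : ℝ) / q)}) ≤ Nat.totient q := by
  rw [generators_eq_image k q hq, Nat.totient_eq_card_coprime]
  exact (finrank_span_finset_le_card _).trans Finset.card_image_le

/-- **Gun–Murty–Rath 2011, Theorem 1** «Let `k > 1` and `q > 2`, then `dim_ℚ V_k(q) ≥ φ(q)/2`»: `V_k^+(q) ≤ V_k(q)` has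
dimension `φ(q)/2` (Okada, `finrank_span_hurwitzEven`). [cite: GunRammurtyRath2011, Theorem 1 (p. 1330; proof p. 1332)] -/
theorem totient_div_two_le_finrank_span {k q : ℕ} (hk : 2 ≤ k) (hq : 3 ≤ q) :
    Nat.totient q / 2 ≤ Module.finrank ℚ ↥(Submodule.span ℚ {y : ℝ | ∃ a : ℕ, 1 ≤ a ∧ a < q ∧ Nat.Coprime a q ∧
        y = hurwitzValue k ((a : ℝ) / q)}) := by
  haveI := finiteDimensional_span k q (by omega)
  rw [← finrank_span_hurwitzEven hk hq]
  exact Submodule.finrank_mono (span_hurwitzEven_le_span (by omega))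

/-! ### Lai–Li's equivalent form of the Chowla–Milnor conjecture -/

/-- **`dim V_k(q) + dim (V_k^+(q) ∩ V_k^−(q)) = φ(q)/2 + dim V_k^−(q)`** (`k ≥ 2`, `q ≥ 3`): the dimension formula for
`V_k(q) = V_k^+(q) + V_k^−(q)` with `dim V_k^+(q) = φ(q)/2`. [cite: LaiLi2025, (1.1) and Conjecture 1.4 (p. 2)]
[cite: GunRammurtyRath2011, proof of Theorem 1 (p. 1332)] -/
theorem finrank_span_add_finrank_inf {k q : ℕ} (hk : 2 ≤ k) (hq : 3 ≤ q) :
    Module.finrank ℚ ↥(Submodule.span ℚ {y : ℝ | ∃ a : ℕ, 1 ≤ a ∧ a < q ∧ Nat.Coprime a q ∧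
        y = hurwitzValue k ((a : ℝ) / q)}) +
      Module.finrank ℚ ↥(Submodule.span ℚ {y : ℝ | ∃ a : ℕ, 1 ≤ a ∧ 2 * a < q ∧ Nat.Coprime a q ∧
          y = hurwitzValue k ((a : ℝ) / q) + (-1 : ℝ) ^ k * hurwitzValue k (1 - (a : ℝ) / q)} ⊓
        oddChowlaMilnorSpace k q) =
      Nat.totient q / 2 + Module.finrank ℚ ↥(oddChowlaMilnorSpace k q) := by
  haveI := finiteDimensional_even k q
  haveI := finiteDimensional_odd k q (by omega)
  rw [← even_sup_odd_eq_span hq, Submodule.finrank_sup_add_finrank_inf_eq, finrank_span_hurwitzEven hk hq]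

/-- **Lai–Li 2025, Conjecture 1.4 is an equivalent form of the Chowla–Milnor conjecture — as a theorem**
(`k ≥ 2`, `q ≥ 3`): `dim_ℚ V_k(q) = φ(q)` («The Chowla–Milnor conjecture asserts that the dimension of `V_k(q)` … is
`φ(q)`», GMR p. 1330) **iff** `dim_ℚ V_k^−(q) = φ(q)/2` and `V_k^+(q) ∩ V_k^−(q) = {0}` (Lai–Li's (1), (2)). Both sides
are OPEN conjectures; only the equivalence is asserted. [cite: LaiLi2025, Conjecture 1.4 with (1.1) (p. 2)]
[cite: GunRammurtyRath2011, Definition 1 and p. 1330] -/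
theorem finrank_span_eq_totient_iff {k q : ℕ} (hk : 2 ≤ k) (hq : 3 ≤ q) :
    Module.finrank ℚ ↥(Submodule.span ℚ {y : ℝ | ∃ a : ℕ, 1 ≤ a ∧ a < q ∧ Nat.Coprime a q ∧
        y = hurwitzValue k ((a : ℝ) / q)}) = Nat.totient q ↔
      Module.finrank ℚ ↥(oddChowlaMilnorSpace k q) = Nat.totient q / 2 ∧
        Submodule.span ℚ {y : ℝ | ∃ a : ℕ, 1 ≤ a ∧ 2 * a < q ∧ Nat.Coprime a q ∧
            y = hurwitzValue k ((a : ℝ) / q) + (-1 : ℝ) ^ k * hurwitzValue k (1 - (a : ℝ) / q)} ⊓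
          oddChowlaMilnorSpace k q = ⊥ := by
  haveI := finiteDimensional_even k q
  haveI := finiteDimensional_odd k q (by omega)
  have hsum := finrank_span_add_finrank_inf (k := k) hk hq
  have hodd := finrank_oddChowlaMilnorSpace_le (k := k) hq
  have heven : Even (Nat.totient q) := Nat.totient_even (by omega)
  obtain ⟨m, hm⟩ := heven
  have hm2 : Nat.totient q / 2 = m := by omega
  rw [hm2] at hsum hodd
  constructor
  · intro h
    rw [h] at hsum
    have hinf : Module.finrank ℚ ↥(Submodule.span ℚ {y : ℝ | ∃ a : ℕ, 1 ≤ a ∧ 2 * a < q ∧ Nat.Coprime a q ∧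
            y = hurwitzValue k ((a : ℝ) / q) + (-1 : ℝ) ^ k * hurwitzValue k (1 - (a : ℝ) / q)} ⊓
          oddChowlaMilnorSpace k q) = 0 := by omega
    refine ⟨by omega, ?_⟩
    exact Submodule.finrank_eq_zero.1 hinf
  · rintro ⟨h1, h2⟩
    rw [h1, h2, finrank_bot] at hsum
    omega

/-- **A non-zero element of `V_k^+(q) ∩ V_k^−(q)` refutes the Chowla–Milnor conjecture at `(k, q)`**: then
`dim_ℚ V_k(q) < φ(q)` (`k ≥ 2`, `q ≥ 3`). [cite: LaiLi2025, Conjecture 1.4 (2) (p. 2)]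
[cite: GunRammurtyRath2011, p. 1330 and p. 1334] -/
theorem finrank_span_lt_totient_of_mem_inf {k q : ℕ} (hk : 2 ≤ k) (hq : 3 ≤ q) {x : ℝ} (hx0 : x ≠ 0)
    (hxe : x ∈ Submodule.span ℚ {y : ℝ | ∃ a : ℕ, 1 ≤ a ∧ 2 * a < q ∧ Nat.Coprime a q ∧
        y = hurwitzValue k ((a : ℝ) / q) + (-1 : ℝ) ^ k * hurwitzValue k (1 - (a : ℝ) / q)})
    (hxo : x ∈ oddChowlaMilnorSpace k q) :
    Module.finrank ℚ ↥(Submodule.span ℚ {y : ℝ | ∃ a : ℕ, 1 ≤ a ∧ a < q ∧ Nat.Coprime a q ∧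
        y = hurwitzValue k ((a : ℝ) / q)}) < Nat.totient q := by
  refine lt_of_le_of_ne (finrank_span_le_totient (by omega)) fun h => hx0 ?_
  have hbot := ((finrank_span_eq_totient_iff hk hq).1 h).2
  have hx : x ∈ Submodule.span ℚ {y : ℝ | ∃ a : ℕ, 1 ≤ a ∧ 2 * a < q ∧ Nat.Coprime a q ∧
        y = hurwitzValue k ((a : ℝ) / q) + (-1 : ℝ) ^ k * hurwitzValue k (1 - (a : ℝ) / q)} ⊓
      oddChowlaMilnorSpace k q := ⟨hxe, hxo⟩
  rw [hbot] at hx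
  exact (Submodule.mem_bot ℚ).1 hx

/-! ### For odd `k` the coprime sum lies in `V_k^−(q)` -/

/-- **For odd `k`, `Σ_{1 ≤ a ≤ q, (a,q)=1} ζ(k, a/q) ∈ V_k^−(q)`** (`q ≥ 3`): pairing `a ↔ q − a` writes the coprime sum
as `Σ_{a < q/2} (ζ(k, a/q) + ζ(k, 1 − a/q)) = Σ_{a < q/2} ζ^−(k, a/q)` since `−(−1)^k = 1` — «`ζ(k)` is a rational multiple
of `Σ (ζ(k, a/q) + ζ(k, 1 − a/q))`», p. 1338 (with `ChowlaMilnorSpaceProofs.sum_coprime_hurwitzValue_eq` the sum is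
`J_k(q)·ζ(k)`). [cite: GunRammurtyRath2011, proof of Proposition 3 (p. 1338)] -/
theorem sum_coprime_hurwitzValue_mem_oddChowlaMilnorSpace {k q : ℕ} (hk : Odd k) (hq : 3 ≤ q) :
    ∑ a ∈ (Finset.Ioc 0 q).filter (fun a => a.Coprime q), hurwitzValue k ((a : ℝ) / q) ∈
      oddChowlaMilnorSpace k q := by
  rw [sum_coprime_eq_sum_halfSystem hq (fun a : ℕ => hurwitzValue k ((a : ℝ) / q))]
  refine Submodule.sum_mem _ fun a ha => ?_
  simp only [mem_filter, mem_range] at ha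
  obtain ⟨haq, h2a, hcop⟩ := ha
  have ha1 : 1 ≤ a := by
    rcases Nat.eq_zero_or_pos a with rfl | hpos
    · rw [Nat.coprime_zero_left] at hcop
      omega
    · exact hpos
  have hq0 : (q : ℝ) ≠ 0 := by exact_mod_cast (show q ≠ 0 by omega)
  have e : hurwitzValue k ((a : ℝ) / q) + hurwitzValue k (((q - a : ℕ) : ℝ) / q) = hurwitzOdd k ((a : ℝ) / q) := by
    rw [hurwitzOdd, Odd.neg_one_pow hk, Nat.cast_sub haq.le]
    have e1 : ((q : ℝ) - a) / q = 1 - (a : ℝ) / q := by field_simp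
    rw [e1]
    ring
  rw [e]
  exact Submodule.subset_span ⟨a, ha1, h2a, hcop, rfl⟩

end Literature.NumberTheory.Irrationality.DirichletLValues

end
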